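import Literature.Computability.AlgebraicComplexity.Kron444HullCheck
import HarnessLib

/-!
# `Kron(4,4,4) ⊆ conv(328 vertices)`: certificate checks, part 4/14

Proofs file (computations only): the node checks of `Kron444HullCheck.lean` for the chunks
38 … 55 of the certificate, each decided by the kernel (`decide +kernel`; `maxHeartbeats 0`:
a chunk is ≈ 10⁵–10⁶ kernel reductions). Assembled in `Kron444Hull.lean`. [folklore]
-/

set_option Elab.async false

namespace Literature.Computability.AlgebraicComplexity.Kron444Hull

/-- Nodes `950 … 974` of the certificate (chunk `38`) pass `checkNodeRec`. [folklore] -/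
theorem checkChunk_38 : checkChunk 38 25 = true := by
  set_option maxHeartbeats 0 in decide +kernel

/-- Nodes `975 … 999` of the certificate (chunk `39`) pass `checkNodeRec`. [folklore] -/
theorem checkChunk_39 : checkChunk 39 25 = true := by
  set_option maxHeartbeats 0 in decide +kernel

/-- Nodes `1000 … 1024` of the certificate (chunk `40`) pass `checkNodeRec`. [folklore] -/
theorem checkChunk_40 : checkChunk 40 25 = true := by
  set_option maxHeartbeats 0 in decide +kernel

/-- Nodes `1025 … 1049` of the certificate (chunk `41`) pass `checkNodeRec`. [folklore] -/
theorem checkChunk_41 : checkChunk 41 25 = true := by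
  set_option maxHeartbeats 0 in decide +kernel

/-- Nodes `1050 … 1074` of the certificate (chunk `42`) pass `checkNodeRec`. [folklore] -/
theorem checkChunk_42 : checkChunk 42 25 = true := by
  set_option maxHeartbeats 0 in decide +kernel

/-- Nodes `1075 … 1099` of the certificate (chunk `43`) pass `checkNodeRec`. [folklore] -/
theorem checkChunk_43 : checkChunk 43 25 = true := by
  set_option maxHeartbeats 0 in decide +kernel

/-- Nodes `1100 … 1124` of the certificate (chunk `44`) pass `checkNodeRec`. [folklore] -/
theorem checkChunk_44 : checkChunk 44 25 = true := by
  set_option maxHeartbeats 0 in decide +kernel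

/-- Nodes `1125 … 1149` of the certificate (chunk `45`) pass `checkNodeRec`. [folklore] -/
theorem checkChunk_45 : checkChunk 45 25 = true := by
  set_option maxHeartbeats 0 in decide +kernel

/-- Nodes `1150 … 1174` of the certificate (chunk `46`) pass `checkNodeRec`. [folklore] -/
theorem checkChunk_46 : checkChunk 46 25 = true := by
  set_option maxHeartbeats 0 in decide +kernel

/-- Nodes `1175 … 1199` of the certificate (chunk `47`) pass `checkNodeRec`. [folklore] -/
theorem checkChunk_47 : checkChunk 47 25 = true := by
  set_option maxHeartbeats 0 in decide +kernel

/-- Nodes `1200 … 1224` of the certificate (chunk `48`) pass `checkNodeRec`. [folklore] -/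
theorem checkChunk_48 : checkChunk 48 25 = true := by
  set_option maxHeartbeats 0 in decide +kernel

/-- Nodes `1225 … 1249` of the certificate (chunk `49`) pass `checkNodeRec`. [folklore] -/
theorem checkChunk_49 : checkChunk 49 25 = true := by
  set_option maxHeartbeats 0 in decide +kernel

/-- Nodes `1250 … 1274` of the certificate (chunk `50`) pass `checkNodeRec`. [folklore] -/
theorem checkChunk_50 : checkChunk 50 25 = true := by
  set_option maxHeartbeats 0 in decide +kernel

/-- Nodes `1275 … 1299` of the certificate (chunk `51`) pass `checkNodeRec`. [folklore] -/
theorem checkChunk_51 : checkChunk 51 25 = true := by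
  set_option maxHeartbeats 0 in decide +kernel

/-- Nodes `1300 … 1324` of the certificate (chunk `52`) pass `checkNodeRec`. [folklore] -/
theorem checkChunk_52 : checkChunk 52 25 = true := by
  set_option maxHeartbeats 0 in decide +kernel

/-- Nodes `1325 … 1349` of the certificate (chunk `53`) pass `checkNodeRec`. [folklore] -/
theorem checkChunk_53 : checkChunk 53 25 = true := by
  set_option maxHeartbeats 0 in decide +kernel

/-- Nodes `1350 … 1374` of the certificate (chunk `54`) pass `checkNodeRec`. [folklore] -/
theorem checkChunk_54 : checkChunk 54 25 = true := by
  set_option maxHeartbeats 0 in decide +kernel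

/-- Nodes `1375 … 1399` of the certificate (chunk `55`) pass `checkNodeRec`. [folklore] -/
theorem checkChunk_55 : checkChunk 55 25 = true := by
  set_option maxHeartbeats 0 in decide +kernel

end Literature.Computability.AlgebraicComplexity.Kron444Hull
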